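import Summits.Ventures.Crystal3D.Theorems.StickyWulffConstantGenericWallFloorStarTransport
import HarnessLib

/-!
# The topmost plate ball owns the closed vertex star too (the `t = p(ℓ)` case of the chain ledger;
# crux `GenericWallFloor`, line `WallLedgerG`)

HONEST FRAMING. Part of the venture `Summits/Ventures/Crystal3D` (cell `crystal3d-full`), helper
`--supports` the crux `GenericWallFloor` (stmt-Ventures-19480), registered line `WallLedgerG`, open stub
`stub_twoSlabAdhesion`.  Companion of `…Chamber` / `…StarTransport` for cf-p1 ROUTE §81(3) TC-2/TC-3:
when the first top of a grain line IS the topmost plate ball `p(ℓ)` («own ⊇ closed lower hemisphere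
63 ⊇ 55»): `down_of_mem_closedStar` (the closed vertex star of `−δ₀` consists of DOWN-slots of the generic
direction `n`), **`plateTop_owns_closedStar`** (all down-slots occupied ⇒ the star is owned),
`plateTop_three_independent` (⇒ three independent occupied slots), `exactOnly_plateTop_of_star_certificate`
(⇒ the own part is exact-only from the ONE C12-55 row, via `exactOnly_star_transport`).

WHAT THIS IS NOT: the «all down-slots of p(ℓ) are occupied» step (plate completeness off the rim) is the
cell's sealing bookkeeping, left to the ledger file; rung F-C1 not moved.
-/

noncomputable section

namespace Summit.Ventures.Crystal3D.Theorems

open Finset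
open scoped InnerProductSpace

variable {X : Finset (EuclideanSpace ℝ (Fin 3))}

/-- **The closed vertex star of `−δ₀` lies in the lower hemisphere of `n`.**  If `δ₀` is the strict
maximiser of `w ↦ ⟪A w, n⟫` over the slots, every slot `w` with `⟪A w, A δ₀⟫ < 0` (i.e. `w = −δ₀` or a
neighbour of `−δ₀`) is a DOWN-slot: `⟪A w, n⟫ < 0`. -/
theorem down_of_mem_closedStar (A : EuclideanSpace ℝ (Fin 3) ≃ₗᵢ[ℝ] EuclideanSpace ℝ (Fin 3))
    (n : EuclideanSpace ℝ (Fin 3)) {δ₀ : EuclideanSpace ℝ (Fin 3)} (hδ₀ : δ₀ ∈ fccSlots)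
    (hmax : ∀ w ∈ fccSlots, w ≠ δ₀ → ⟪A w, n⟫_ℝ < ⟪A δ₀, n⟫_ℝ)
    {w : EuclideanSpace ℝ (Fin 3)} (hw : w ∈ fccSlots) (hstar : ⟪A w, A δ₀⟫_ℝ < 0) : ⟪A w, n⟫_ℝ < 0 := by
  rcases (mem_closedStar_iff A hδ₀ hw).2 hstar with rfl | h
  · rw [map_neg, inner_neg_left]; linarith [argmax_pos A n hδ₀ hmax]
  · -- `−w` is a neighbour of `δ₀`, hence an up-slot
    have hadj : ⟪-w, δ₀⟫_ℝ = 1 / 2 := by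
      rw [inner_neg_left]; rw [inner_neg_right] at h; linarith
    have := pos_of_adj_argmax A n hδ₀ hmax (neg_mem_fccSlots hw) hadj
    rw [map_neg, inner_neg_left] at this; linarith

/-- **The topmost plate ball owns the closed vertex star** (the `t = p(ℓ)` case of TC-2/TC-3): if every
DOWN-slot of `p` is occupied (`p + A w ∈ X` whenever `⟪A w, n⟫ < 0` — true for the topmost ball of a
grain line inside a complete plate, off the rim), then `p + A w ∈ X` for every `w` in the closed vertex
star of `−δ₀`. -/
theorem plateTop_owns_closedStar (A : EuclideanSpace ℝ (Fin 3) ≃ₗᵢ[ℝ] EuclideanSpace ℝ (Fin 3))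
    (n : EuclideanSpace ℝ (Fin 3)) {δ₀ : EuclideanSpace ℝ (Fin 3)} (hδ₀ : δ₀ ∈ fccSlots)
    (hmax : ∀ w ∈ fccSlots, w ≠ δ₀ → ⟪A w, n⟫_ℝ < ⟪A δ₀, n⟫_ℝ)
    {p : EuclideanSpace ℝ (Fin 3)} (hlow : ∀ w ∈ fccSlots, ⟪A w, n⟫_ℝ < 0 → p + A w ∈ X)
    {w : EuclideanSpace ℝ (Fin 3)} (hw : w ∈ fccSlots) (hstar : ⟪A w, A δ₀⟫_ℝ < 0) : p + A w ∈ X :=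
  hlow w hw (down_of_mem_closedStar A n hδ₀ hmax hw hstar)

/-- **Three independent occupied slots at the topmost plate ball.** -/
theorem plateTop_three_independent (A : EuclideanSpace ℝ (Fin 3) ≃ₗᵢ[ℝ] EuclideanSpace ℝ (Fin 3))
    (n : EuclideanSpace ℝ (Fin 3)) {δ₀ : EuclideanSpace ℝ (Fin 3)} (hδ₀ : δ₀ ∈ fccSlots)
    (hmax : ∀ w ∈ fccSlots, w ≠ δ₀ → ⟪A w, n⟫_ℝ < ⟪A δ₀, n⟫_ℝ)
    {p : EuclideanSpace ℝ (Fin 3)} (hlow : ∀ w ∈ fccSlots, ⟪A w, n⟫_ℝ < 0 → p + A w ∈ X) :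
    ∃ w₁ ∈ fccSlots, ∃ w₂ ∈ fccSlots, ∃ w₃ ∈ fccSlots,
      p + A w₁ ∈ X ∧ p + A w₂ ∈ X ∧ p + A w₃ ∈ X ∧ LinearIndependent ℝ ![w₁, w₂, w₃] := by
  have hν : A δ₀ ≠ 0 := by
    intro h
    have := norm_eq_one_of_mem_fccSlots hδ₀
    rw [← A.norm_map, h, norm_zero] at this; exact one_ne_zero this.symm
  obtain ⟨w₁, hw₁, w₂, hw₂, w₃, hw₃, h₁, h₂, h₃, hind⟩ := exists_independent_slots_of_hemisphere A hν
  exact ⟨w₁, hw₁, w₂, hw₂, w₃, hw₃, plateTop_owns_closedStar A n hδ₀ hmax hlow hw₁ h₁,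
    plateTop_owns_closedStar A n hδ₀ hmax hlow hw₂ h₂, plateTop_owns_closedStar A n hδ₀ hmax hlow hw₃ h₃, hind⟩

/-- **The own part of the topmost plate ball is exact-only** from the C12-55 star certificate (the
`t = p(ℓ)` case of TC-3; `63 ⊇ 55` in the planner's orbit numbering). -/
theorem exactOnly_plateTop_of_star_certificate
    {s₀ : EuclideanSpace ℝ (Fin 3)} (hs₀ : s₀ ∈ fccSlots)
    (hcert : ExactOnly 0 (fccSlots.filter fun w => 0 < ⟪w, s₀⟫_ℝ))
    (A : EuclideanSpace ℝ (Fin 3) ≃ₗᵢ[ℝ] EuclideanSpace ℝ (Fin 3)) (n : EuclideanSpace ℝ (Fin 3))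
    {δ₀ : EuclideanSpace ℝ (Fin 3)} (hδ₀ : δ₀ ∈ fccSlots)
    (hmax : ∀ w ∈ fccSlots, w ≠ δ₀ → ⟪A w, n⟫_ℝ < ⟪A δ₀, n⟫_ℝ)
    {p : EuclideanSpace ℝ (Fin 3)} (hlow : ∀ w ∈ fccSlots, ⟪A w, n⟫_ℝ < 0 → p + A w ∈ X)
    {O : Finset (EuclideanSpace ℝ (Fin 3))} (hO : ∀ w ∈ fccSlots, p + A w ∈ X → p + A w ∈ O) :
    ExactOnly p O := by
  classical
  have hstar := exactOnly_star_transport hs₀ hcert A p (neg_mem_fccSlots hδ₀)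
  refine hstar.mono ?_
  intro x hx
  obtain ⟨w, hw, rfl⟩ := Finset.mem_image.1 hx
  obtain ⟨hwS, hpos⟩ := Finset.mem_filter.1 hw
  have hlt : ⟪A w, A δ₀⟫_ℝ < 0 := by
    rw [LinearIsometryEquiv.inner_map_map]; rw [inner_neg_right] at hpos; linarith
  exact hO w hwS (plateTop_owns_closedStar A n hδ₀ hmax hlow hwS hlt)

end Summit.Ventures.Crystal3D.Theorems

end
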